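import Summits.BirchSwinnertonDyer.BirchSwinnertonDyer.Theses.QuadraticBranchSignedControl
import Summits.BirchSwinnertonDyer.BirchSwinnertonDyer.Theorems.QuadraticBranchSignedControlPlusLowerInclusionOfEta
import Summits.BirchSwinnertonDyer.BirchSwinnertonDyer.Theorems.QuadraticBranchSignedControlPlusKatoDivisibilityOfNamedFacts
import HarnessLib

/-!
# Route `QuadraticBranchSignedControl` (rung K8, cell `bsd-potss`): the η-package glue items
# 19605 `PlusLowerInclusionSurjBranchOfEta` and 19614 `PlusKatoDivisibilityBranchOfNamedFacts`

WHAT. The tenure planner (g13, TARGET R102a) split the two cruxes 19242 `PlusLowerInclusionSurjBranch`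
(E⁺|surj) and 19241 `PlusKatoDivisibilityBranch` (RK⁺) of the K8 route into children «print-currency
η-node ∧ ∀-form descent frame ∧ held Kobayashi inputs» plus one GLUE item each:
* 19605: `PlusEtaLowerInclusion → EtaDescentFrameSurj → PublishedInputKobThm12Lower →
  PublishedInputKobThm22Lower → PlusLowerInclusionSurjBranch`;
* 19614: `EtaDescentFrame → PublishedInputKobThm41 → PublishedInputKobThm22 → PublishedInputKobThm12 →
  PlusKatoDivisibilityBranch`.
Both glue statements are proved here, by the planner-certified terms: 19614 is seat k8q-c2's
`plusKatoDivisibilityBranch_of_namedFacts_of_decomposition` (p422507) verbatim; 19605 is k8q-c2's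
per-pair transport `quadraticBranchPlusLowerInclusionAt_of_etaLowerInclusion_of_decomposition`
(p421483) at `K₀ = ℚ(ζ_p)` (`exists_theta_eta_cyclotomicField`, `normal_galRange_cyclotomic`),
re-threaded with the surjective-row frame and the node-currency child.

HONEST FRAMING (cell `bsd-potss`, run/shared/lean/pub/bsd-potss/; FULL-BSD rank ≤ 1 programme):
GLUE ONLY — implications «children ⟹ parent»; every antecedent (the η-node lower inclusion
`PlusEtaLowerInclusion` = Kato's lower IMC inclusion for the additive twist at η, OPEN class-wide;
the descent frames; Kobayashi's Thm. 1.2 / 2.2 / 4.1 as held published inputs) stays in hypothesis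
position. Nothing about (E⁺), (RK⁺), (C1_η) or `BSD(W, p)` is claimed for any pair; no definition,
no named fact, no `sorry`, axioms standard. Seat `bsd-potss-k8eta-c1` (prover), g0.

References: [Kobayashi2003] Def. 1.1 (p. 2), Thm. 1.2 (p. 2), Def. 2.1 / Thm. 2.2 (p. 5), §4 p. 8,
Thm. 4.1 (p. 8); [Kato2004Asterisque] Thm. 12.5, Conj. 12.10; [GreenbergLNM1716] §3.
-/

set_option autoImplicit false
set_option linter.dupNamespace false

noncomputable section

open scoped Classical

open CongruenceSubgroup Field WeierstrassCurve
open Literature.NumberTheory.EllipticCurves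
open Literature.NumberTheory.EllipticCurves.ModularForms
open Literature.NumberTheory.GaloisRepresentations
open Summit.BirchSwinnertonDyer.Rank1Residual.Additive
open Summit.BirchSwinnertonDyer.Rank1Residual.Additive.SignedTwist
open Summit.BirchSwinnertonDyer.BirchSwinnertonDyer.Theses.QuadraticBranchSignedControl

namespace Summit.BirchSwinnertonDyer.BirchSwinnertonDyer.Theorems

/-- **Glue item 19614** (`PlusKatoDivisibilityBranchOfNamedFacts`): the ∀-form descent frame, Kobayashi's
Thm. 4.1 (plus η-divisibility), Thm. 2.2 at η and Thm. 1.2 imply (RK⁺) on every Gss2 pair — seat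
k8q-c2's `plusKatoDivisibilityBranch_of_namedFacts_of_decomposition` with the arguments re-ordered.
GLUE (implication only). [cite: Kobayashi2003, Thm. 4.1 (p. 8), Thm. 2.2 (p. 5), Thm. 1.2 (p. 2)]
[cite: Kato2004Asterisque, Thm. 12.5] -/
theorem plusKatoDivisibilityBranchOfNamedFacts_proof : PlusKatoDivisibilityBranchOfNamedFacts :=
  fun hdec h41 h22 h12 => plusKatoDivisibilityBranch_of_namedFacts_of_decomposition h41 h22 h12 hdec

/-- **Glue item 19605** (`PlusLowerInclusionSurjBranchOfEta`): on the onto-tower rows, the η-node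
lower inclusion (E⁺_η) together with the surjective-row descent frame and Kobayashi's Thm. 1.2 /
Thm. 2.2 at η gives the parent crux (E⁺|surj) — k8q-c2's per-pair transport
`quadraticBranchPlusLowerInclusionAt_of_etaLowerInclusion_of_decomposition` at `K₀ = ℚ(ζ_p)` with
Kobayashi's `η = ω^{(p−1)/2}` (`exists_theta_eta_cyclotomicField`). GLUE (implication only).
[cite: Kobayashi2003, §4 p. 8 (the η-component of X⁺ and L_p⁺(E,η,X)), Thm. 1.2 (p. 2), Thm. 2.2 (p. 5)] -/
theorem plusLowerInclusionSurjBranchOfEta_proof : PlusLowerInclusionSurjBranchOfEta := by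
  intro hE hdec h12 h22 V _ _ p _ hp5 hgood hap hs
  have hp2 : p ≠ 2 := by omega
  haveI : NeZero p := ⟨(Fact.out : p.Prime).ne_zero⟩
  haveI : IsCyclotomicExtension {p} ℚ (CyclotomicField p ℚ) :=
    CyclotomicField.isCyclotomicExtension p ℚ
  haveI : (galRange (K := ℚ) (CyclotomicField p ℚ)).Normal := normal_galRange_cyclotomic p _
  obtain ⟨θ, ηq, -, -, -, hηK, hη1⟩ := exists_theta_eta_cyclotomicField p hp2
  exact quadraticBranchPlusLowerInclusionAt_of_etaLowerInclusion_of_decomposition h12 h22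
    (CyclotomicField p ℚ) ηq hηK
    (fun κ γ hκ hγ hγK hγc F _ _ V' _ κF γF hF hθ hC hκF hγF hζ =>
      hdec p hp5 (CyclotomicField p ℚ) ηq hηK hη1 V hgood hap hs κ γ hκ hγ hγK hγc F V' κF γF hF hθ
        hC hκF hγF hζ)
    (fun hp2' hgood' hap' hf ϖ hϖ Lη hL κ γ hκ hγ hγK hγc Dη =>
      hE V p hp5 hgood hap hs (CyclotomicField p ℚ) ηq hηK hη1 hp2' hgood' hap' hf ϖ hϖ Lη hL κ γ
        hκ hγ hγK hγc Dη)

end Summit.BirchSwinnertonDyer.BirchSwinnertonDyer.Theorems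

end
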